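/-
Copyright (c) 2026 the pub-hodgecm-mathlib formalisation cell (harness21).  Prover seat hodgecm-mathlib-LH4-p09 (g3), req620 Track A «(D-RAM) FOUR-FRAME» squad
(unit U3_Laws, κ-STAGE B brick κB-G «GLUED-STRATA κ-SOCKETS», dealer LH4-plan (g11) WORD #32 (3); letter `F0/P3c/LH4/LH4-p09/g3/LETTER-kappaBG-RHS.v1.LH4p09g3.md` §2–§3,
LH4-p05 (g3) «=» 2026-09-04T01:37:11Z).  FILE κG-B2.  2026-09-04.
-/
import Summits.HodgeConjecture.HodgeConjecture.Theorems.F0P3cDyRamDiagonalFixedClassSystems   -- κG-B1 (this seat): `sum_eq_zero_of_twist`, `sum_eq_sum_of_repr`, `card_eq_card_of_repr`, `exists_repr_fixedBall_card`; brings ★ (iv-c)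
import Literature.NumberTheory.LocalFields.WildQuadraticDatumNormSignConductor                -- ★ (LH4-p06 (g3)) κ-toolkit: `exists_fixed_unit_not_norm_v_sub_one_le`, `normSign_eq_of_near`, `normSign_mul_eq_neg_of_not_norm`, `normSign_eq_one_of_fixed_of_v_sub_one_le`
import Summits.HodgeConjecture.HodgeConjecture.Theorems.F0P3cDyRamFixedCountDiagonalModel      -- ★ p855032 (LH4-p11): `normSign_mul_norm`
import HarnessLib

/-!
# Crux `H413`, line LH4 «(D-RAM) FOUR-FRAME» road — unit U3_Laws (iii), κ-STAGE B, FILE κG-B2 «CHARACTER SUMS OVER THE FIXED CLASSES OF LEVEL `2t`»: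
# `Σ ω(g)`, `Σ ω(g)ω(1+g)`, `Σ ω(1+g)` over a system of representatives of `{g = σg, |g| = |ϖ|^{2t}}` modulo `𝔭^{ρ+2t}` — and over its sub-balls

Cell `hodgecm-mathlib` (D-0151), FLOOR 0, crux item H413 = `stmt-HodgeConjecture-24833`, route of record `HCCMUnconditional`; squad F0∕P3c∕LH4 (req618∕req620).  THEOREMS ONLY
(no `def`, no instance, no notation, no `sorry`); lane `--supports stmt-HodgeConjecture-24833 --as helper` (count-neutral).  LAW-FREE.

THE MATHEMATICS (letter §2–§3; `ω = normSign σ`, conductor `d`: `ω ≡ 1` on the fixed units `≡ 1 (ϖ^{2d−1})` — ★ LH4-p06 (g3) — and a fixed NON-norm `n ≡ 1 (ϖ^{2d−2})` exists).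
On the glued stratum `G₁(2ρ, 2t)` the κ-census is `mass × Σ_{g ∈ R} κ_i(g)` over a system `R` of representatives of the fixed `g` with `|g| = |ϖ|^{2t}` modulo `𝔭^{ρ+2t}` (FILE κG-A,
★ (iv-a)(iv-c)), with `κ_0 = [2d ≤ ρ+2t+1]·ω(−1)ω(1+g)`, `κ_1 = [2d ≤ ρ+1]·ω(−1)ω(g)ω(1+g)`, `κ_2 = [2d ≤ ρ+1]·ω(g)`.  Under the brackets the summands are CLASS FUNCTIONS and:
* §2 `Σ_S ω(g) = 0` and `Σ_S ω(g)ω(1+g) = 0` for `2d ≤ ρ + 1` — twist `g ↦ n·g` (`ω(ng) = −ω(g)`, `ω(1+ng) = ω(1+g)` as `|n−1||g| ≤ |ϖ|^{2d−2+2t}`), on ANY `A ⊆ {fixed, level 2t}` stable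
  under the fixed one-units of level `2d−2` (all of it; the glue sub-balls);
* §3 `Σ_S ω(1+g)`: `= #S` for `d ≤ t` (deep norms); `= 0` for `t + 2 ≤ d` under the window `2d ≤ ρ+2t+1` — twist `g ↦ n(1+g) − 1` (stays at level `2t` since `|n−1| < |g|`); and at the
  BOUNDARY `t + 1 = d`: `= −q^{⌈ρ∕2⌉−1}` — the twist permutes the classes of the whole BALL `{|x| ≤ |ϖ|^{2t}}` (`q^{⌈ρ∕2⌉}` of them, κG-B1), on which the sum is therefore `0`, while
  the deep classes `|x| ≤ |ϖ|^{2t+2} = |ϖ|^{2d}` all have `ω(1+x) = +1` and number `q^{⌈ρ∕2⌉} − (q−1)q^{⌈ρ∕2⌉−1}` (★ (iv-c));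
* §4 the constant cases on a sub-ball `{fixed g : |g − c₀| ≤ |ϖ|^k}` (`|c₀| = |ϖ|^{2t}`): `Σ_S ω(1+g) = #S·ω(1+c₀)` for `2d−1 ≤ k`, `Σ_S ω(g) = #S·ω(c₀)` and `Σ_S ω(g)ω(1+g) = #S·ω(c₀)ω(1+c₀)` for
  `2d−1+2t ≤ k`; and its class count `#S = q^{⌈(ρ+2t)∕2⌉ − ⌈k∕2⌉}` (κG-B1 ball count, translated).
HONEST LABEL.  Count-neutral (`--supports`); nothing printed is asserted; (KMS)∕(KSS) stay PROVER TARGETS; `HC_CM` is proved only modulo the 7 printed citations (2 remaining named inputs: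
hLiu418 = `stmt-HodgeConjecture-24832`, h413 = `stmt-HodgeConjecture-24833`) until rung 0 closes.

## References
* [Serre1979] J.-P. Serre, *Local Fields*, GTM 67 (1979), Ch. V §3 Prop. 5, Cor. 3 (conductor and unit norm index of a ramified quadratic extension), Ch. XV §2.
* [LanglandsShelstad1987] R. P. Langlands, D. Shelstad, *On the definition of transfer factors*, Math. Ann. 278 (1987), §3 (κ-signs as characters).
* [Kottwitz1986BaseChangeUnits] R. E. Kottwitz, *Base change for unit elements of Hecke algebras*, Compositio Math. 60 (1986), §1 pp. 240–241.
-/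

set_option autoImplicit false

noncomputable section

namespace Summit.HodgeConjecture.HodgeConjecture.Cruxes.H413.F0P3cDyRamDiagonalKappaGluedClassSums

open WithZero
open Literature.NumberTheory.Automorphic Literature.NumberTheory.Automorphic.UnitaryThreeFourFrame
open Literature.NumberTheory.LocalFields.WildQuadraticDatum
open Summit.HodgeConjecture.HodgeConjecture.Cruxes.H413.F0P3cDyRamDiagonalFixedClassSystems
open Summit.HodgeConjecture.HodgeConjecture.Cruxes.H413.F0P3cDyRamDiagonalGluedClassRepresentatives (exists_fixed_class_representatives)
open Summit.HodgeConjecture.HodgeConjecture.Cruxes.H413.F0P3cDyRamFixedCountDiagonalModel (normSign_mul_norm)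
open scoped Valued

variable {K : Type} [Field K] [Valued K ℤᵐ⁰] [CompleteSpace K] [Finite 𝓀[K]] {σ : K →+* K} {ϖ : K} {d t₂ : ℕ}

/-! ## §1  `ω(g)` and `ω(1+g)` are class functions at level `2t` under the windows -/

omit [CompleteSpace K] [Finite 𝓀[K]] in
/-- `ω(g) = ω(g·π₀^{−t})` (`π₀^{−t} = N(ϖ^{−t})` is a norm). [cite: Serre1979, Ch. V §3 Prop. 5, Cor. 3] -/
theorem normSign_eq_normSign_mul_inv_pow (hD : IsRamifiedQuadraticDatum σ ϖ d t₂) (t : ℕ) (g : K) :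
    normSign σ g = normSign σ (g * ((ϖ * σ ϖ) ^ t)⁻¹) := by
  have hσ := hD.1
  have hϖ0 : ϖ ≠ 0 := fun h0 => by have h := hD.2.2.1; rw [h0, map_zero] at h; exact WithZero.coe_ne_zero h.symm
  have e : ((ϖ * σ ϖ) ^ t)⁻¹ = (ϖ ^ t)⁻¹ * σ ((ϖ ^ t)⁻¹) := by rw [map_inv₀, map_pow, mul_pow, mul_inv]
  rw [e, normSign_mul_norm σ g (inv_ne_zero (pow_ne_zero _ hϖ0))]

omit [Finite 𝓀[K]] in
/-- **`ω` IS A CLASS FUNCTION ON THE FIXED ELEMENTS OF LEVEL `2t` MODULO `𝔭^{ρ+2t}` WHEN `2d ≤ ρ + 1`** (rescale to units by `π₀^{−t}` and use ★ `normSign_eq_of_near`).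
[cite: Serre1979, Ch. V §3 Prop. 5, Cor. 3; Ch. XV §2] -/
theorem normSign_eq_of_near_level (hD : IsRamifiedQuadraticDatum σ ϖ d t₂) {ρ t : ℕ} (hρ : 2 * d ≤ ρ + 1) {g g' : K} (hσg : σ g = g) (hσg' : σ g' = g')
    (hg : Valued.v g = Valued.v ϖ ^ (2 * t)) (h : Valued.v (g - g') ≤ Valued.v ϖ ^ (ρ + 2 * t)) : normSign σ g' = normSign σ g := by
  have hσ := hD.1; have hvσ := hD.2.1; have hϖ := hD.2.2.1
  have hϖ0 : ϖ ≠ 0 := fun h0 => by rw [h0, map_zero] at hϖ; exact WithZero.coe_ne_zero hϖ.symm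
  have hvϖ : 0 < Valued.v ϖ := (Valuation.pos_iff _).2 hϖ0
  set c : K := ((ϖ * σ ϖ) ^ t)⁻¹ with hc
  have hσc : σ c = c := by rw [hc, map_inv₀, map_pow, map_mul, hσ, mul_comm (σ ϖ)]
  have hvc : Valued.v c = (Valued.v ϖ ^ (2 * t))⁻¹ := by rw [hc, map_inv₀, map_pow, map_mul, hvσ, ← pow_two, ← pow_mul]
  rw [normSign_eq_normSign_mul_inv_pow hD t g, normSign_eq_normSign_mul_inv_pow hD t g']
  refine normSign_eq_of_near hD (by rw [map_mul, hσg, hσc]) (by rw [map_mul, hσg', hσc]) (by rw [map_mul, hg, hvc, mul_inv_cancel₀ (pow_ne_zero _ hvϖ.ne')])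
    (n := ρ) (by omega) ?_
  rw [← sub_mul, map_mul, hvc]
  calc Valued.v (g - g') * (Valued.v ϖ ^ (2 * t))⁻¹ ≤ Valued.v ϖ ^ (ρ + 2 * t) * (Valued.v ϖ ^ (2 * t))⁻¹ := mul_le_mul_left h _
    _ = Valued.v ϖ ^ ρ := by rw [pow_add, mul_assoc, mul_inv_cancel₀ (pow_ne_zero _ hvϖ.ne'), mul_one]

omit [Finite 𝓀[K]] in
/-- **`ω(1+·)` IS A CLASS FUNCTION MODULO `𝔭^n` FOR `2d − 1 ≤ n`** on elements of valuation `< 1`. [cite: Serre1979, Ch. XV §2] -/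
theorem normSign_one_add_eq_of_near (hD : IsRamifiedQuadraticDatum σ ϖ d t₂) {n : ℕ} (hn : 2 * d - 1 ≤ n) {g g' : K} (hσg : σ g = g) (hσg' : σ g' = g')
    (hg : Valued.v g < 1) (h : Valued.v (g - g') ≤ Valued.v ϖ ^ n) : normSign σ (1 + g') = normSign σ (1 + g) :=
  normSign_eq_of_near hD (by rw [map_add, map_one, hσg]) (by rw [map_add, map_one, hσg']) (Valued.v.map_one_add_of_lt hg) hn
    (by rw [show (1 : K) + g - (1 + g') = g - g' by ring]; exact h)

/-! ## §2  `Σ ω(g) = 0` and `Σ ω(g)ω(1+g) = 0` under `2d ≤ ρ + 1`, on any level-`2t` set stable under the fixed one-units of level `2d − 2` -/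

/-- **`Σ_S ω(g) = 0`** (`2d ≤ ρ+1`): `S` a complete irredundant system modulo `𝔭^{ρ+2t}` of a set `A` of fixed elements of valuation `|ϖ|^{2t}` that is STABLE under multiplication by every
fixed unit `n ≡ 1 (ϖ^{2d−2})`; twist `g ↦ n·g` with the non-norm `n` of ★ `exists_fixed_unit_not_norm_v_sub_one_le`. [cite: Serre1979, Ch. V §3 Prop. 5, Cor. 3] [cite: LanglandsShelstad1987, §3] -/
theorem sum_normSign_eq_zero (hD : IsRamifiedQuadraticDatum σ ϖ d t₂) (h2 : Valued.v (2 : K) < 1) {ρ t : ℕ} (hρ : 2 * d ≤ ρ + 1)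
    {A : Set K} (hA : ∀ g ∈ A, σ g = g ∧ Valued.v g = Valued.v ϖ ^ (2 * t))
    (hAst : ∀ g ∈ A, ∀ n : K, σ n = n → Valued.v n = 1 → Valued.v (n - 1) ≤ Valued.v ϖ ^ (2 * (d - 1)) → n * g ∈ A)
    (S : Finset K) (hS1 : ∀ g ∈ S, g ∈ A) (hS2 : ∀ f ∈ A, ∃ g ∈ S, Valued.v (f - g) ≤ Valued.v ϖ ^ (ρ + 2 * t))
    (hS3 : ∀ g ∈ S, ∀ g' ∈ S, Valued.v (g - g') ≤ Valued.v ϖ ^ (ρ + 2 * t) → g = g') :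
    ∑ g ∈ S, normSign σ g = 0 := by
  have hϖ := hD.2.2.1
  have hϖ0 : ϖ ≠ 0 := fun h0 => by rw [h0, map_zero] at hϖ; exact WithZero.coe_ne_zero hϖ.symm
  have hvϖ : 0 < Valued.v ϖ := (Valuation.pos_iff _).2 hϖ0
  obtain ⟨n, hσn, hn1, hnd, hnn⟩ := exists_fixed_unit_not_norm_v_sub_one_le hD h2
  have hnd' : Valued.v (n - 1) ≤ Valued.v ϖ ^ (2 * (d - 1)) := by
    rw [v_varpi_pow hϖ]; convert hnd using 2; push_cast; ring
  refine sum_eq_zero_of_twist S hS1 hS2 hS3 (fun g => normSign σ g) (fun f hf f' hf' h => ?_) (fun g => n * g) (fun f hf => hAst f hf n hσn hn1 hnd')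
    (fun f _ f' _ h => ?_) (fun f hf => ?_)
  · exact (normSign_eq_of_near_level hD hρ (hA f hf).1 (hA f' hf').1 (hA f hf).2 h).symm
  · rwa [← mul_sub, map_mul, hn1, one_mul] at h
  · have hf0 : f ≠ 0 := fun h0 => by have h := (hA f hf).2; rw [h0, map_zero] at h; exact (pow_ne_zero _ hvϖ.ne') h.symm
    exact normSign_mul_eq_neg_of_not_norm hD hσn hnn (hA f hf).1 hf0

/-- **`Σ_S ω(g)·ω(1+g) = 0`** (`2d ≤ ρ+1`, `1 ≤ t`; same setting): the twist `g ↦ n·g` flips `ω(g)` and fixes `ω(1+g)` (`|(1+ng) − (1+g)| = |n−1||g| ≤ |ϖ|^{2d−2+2t}`, `2d−1 ≤ 2d−2+2t`).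
[cite: Serre1979, Ch. V §3 Prop. 5, Cor. 3] [cite: LanglandsShelstad1987, §3] -/
theorem sum_normSign_mul_normSign_one_add_eq_zero (hD : IsRamifiedQuadraticDatum σ ϖ d t₂) (h2 : Valued.v (2 : K) < 1) {ρ t : ℕ} (hρ : 2 * d ≤ ρ + 1)
    (ht : 1 ≤ t) {A : Set K} (hA : ∀ g ∈ A, σ g = g ∧ Valued.v g = Valued.v ϖ ^ (2 * t))
    (hAst : ∀ g ∈ A, ∀ n : K, σ n = n → Valued.v n = 1 → Valued.v (n - 1) ≤ Valued.v ϖ ^ (2 * (d - 1)) → n * g ∈ A)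
    (S : Finset K) (hS1 : ∀ g ∈ S, g ∈ A) (hS2 : ∀ f ∈ A, ∃ g ∈ S, Valued.v (f - g) ≤ Valued.v ϖ ^ (ρ + 2 * t))
    (hS3 : ∀ g ∈ S, ∀ g' ∈ S, Valued.v (g - g') ≤ Valued.v ϖ ^ (ρ + 2 * t) → g = g') :
    ∑ g ∈ S, normSign σ g * normSign σ (1 + g) = 0 := by
  have hϖ := hD.2.2.1
  have hϖ0 : ϖ ≠ 0 := fun h0 => by rw [h0, map_zero] at hϖ; exact WithZero.coe_ne_zero hϖ.symm
  have hvϖ : 0 < Valued.v ϖ := (Valuation.pos_iff _).2 hϖ0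
  have hϖ1 : Valued.v ϖ < 1 := by rw [hϖ, ← exp_zero, exp_lt_exp]; norm_num
  have hlt1 : ∀ f ∈ A, Valued.v f < 1 := fun f hf => by rw [(hA f hf).2]; exact pow_lt_one₀ zero_le hϖ1 (by omega)
  obtain ⟨n, hσn, hn1, hnd, hnn⟩ := exists_fixed_unit_not_norm_v_sub_one_le hD h2
  have hnd' : Valued.v (n - 1) ≤ Valued.v ϖ ^ (2 * (d - 1)) := by
    rw [v_varpi_pow hϖ]; convert hnd using 2; push_cast; ring
  refine sum_eq_zero_of_twist S hS1 hS2 hS3 (fun g => normSign σ g * normSign σ (1 + g)) (fun f hf f' hf' h => ?_) (fun g => n * g)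
    (fun f hf => hAst f hf n hσn hn1 hnd') (fun f _ f' _ h => ?_) (fun f hf => ?_)
  · rw [(normSign_eq_of_near_level hD hρ (hA f hf).1 (hA f' hf').1 (hA f hf).2 h).symm,
      normSign_one_add_eq_of_near hD (n := ρ + 2 * t) (by omega) (hA f hf).1 (hA f' hf').1 (hlt1 f hf) h]
  · rwa [← mul_sub, map_mul, hn1, one_mul] at h
  · have hf0 : f ≠ 0 := fun h0 => by have h := (hA f hf).2; rw [h0, map_zero] at h; exact (pow_ne_zero _ hvϖ.ne') h.symm
    have hnear : Valued.v (f - n * f) ≤ Valued.v ϖ ^ (2 * (d - 1) + 2 * t) := by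
      rw [show f - n * f = -((n - 1) * f) by ring, Valuation.map_neg, map_mul, (hA f hf).2, pow_add]
      exact mul_le_mul_left hnd' _
    rw [normSign_mul_eq_neg_of_not_norm hD hσn hnn (hA f hf).1 hf0,
      normSign_one_add_eq_of_near hD (n := 2 * (d - 1) + 2 * t) (by omega) (hA f hf).1 (by rw [map_mul, hσn, (hA f hf).1]) (hlt1 f hf) hnear]
    ring

/-! ## §3  `Σ ω(1+g)`: deep, dead, and the boundary -/

omit [Finite 𝓀[K]] in
/-- **DEEP (`d ≤ t`): every `ω(1+g) = 1`, so `Σ_S ω(1+g) = #S`.** [cite: Serre1979, Ch. XV §2] -/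
theorem sum_normSign_one_add_eq_card_of_le (hD : IsRamifiedQuadraticDatum σ ϖ d t₂) {t : ℕ} (hdt : d ≤ t)
    (S : Finset K) (hS1 : ∀ g ∈ S, σ g = g ∧ Valued.v g = Valued.v ϖ ^ (2 * t)) :
    ∑ g ∈ S, normSign σ (1 + g) = S.card := by
  rw [Finset.card_eq_sum_ones, Nat.cast_sum, Nat.cast_one]
  refine Finset.sum_congr rfl fun g hg => ?_
  exact normSign_eq_one_of_fixed_of_v_sub_one_le hD (by rw [map_add, map_one, (hS1 g hg).1]) (n := 2 * t) (by omega)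
    (by rw [add_sub_cancel_left, (hS1 g hg).2])

/-- **DEAD BELOW THE BOUNDARY (`t + 2 ≤ d`, window `2d ≤ ρ+2t+1`): `Σ_S ω(1+g) = 0`** on any set `A` of fixed elements of level `2t` stable under `g ↦ n(1+g) − 1` for the fixed one-units
`n ≡ 1 (ϖ^{2d−2})` (all of the level; the glue sub-balls of radius `≥ |ϖ|^{2d−2}`) — the twist flips `ω(1+g)`. [cite: Serre1979, Ch. V §3 Prop. 5, Cor. 3] [cite: LanglandsShelstad1987, §3] -/
theorem sum_normSign_one_add_eq_zero (hD : IsRamifiedQuadraticDatum σ ϖ d t₂) (h2 : Valued.v (2 : K) < 1) {ρ t : ℕ} (ht : 1 ≤ t)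
    (hwin : 2 * d ≤ ρ + 2 * t + 1) {A : Set K} (hA : ∀ g ∈ A, σ g = g ∧ Valued.v g = Valued.v ϖ ^ (2 * t))
    (hAst : ∀ g ∈ A, ∀ n : K, σ n = n → Valued.v n = 1 → Valued.v (n - 1) ≤ Valued.v ϖ ^ (2 * (d - 1)) → n * (1 + g) - 1 ∈ A)
    (S : Finset K) (hS1 : ∀ g ∈ S, g ∈ A) (hS2 : ∀ f ∈ A, ∃ g ∈ S, Valued.v (f - g) ≤ Valued.v ϖ ^ (ρ + 2 * t))
    (hS3 : ∀ g ∈ S, ∀ g' ∈ S, Valued.v (g - g') ≤ Valued.v ϖ ^ (ρ + 2 * t) → g = g') :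
    ∑ g ∈ S, normSign σ (1 + g) = 0 := by
  have hϖ := hD.2.2.1
  have hϖ0 : ϖ ≠ 0 := fun h0 => by rw [h0, map_zero] at hϖ; exact WithZero.coe_ne_zero hϖ.symm
  have hvϖ : 0 < Valued.v ϖ := (Valuation.pos_iff _).2 hϖ0
  have hϖ1 : Valued.v ϖ < 1 := by rw [hϖ, ← exp_zero, exp_lt_exp]; norm_num
  have hlt1 : ∀ f ∈ A, Valued.v f < 1 := fun f hf => by rw [(hA f hf).2]; exact pow_lt_one₀ zero_le hϖ1 (by omega)
  obtain ⟨n, hσn, hn1, hnd, hnn⟩ := exists_fixed_unit_not_norm_v_sub_one_le hD h2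
  have hnd' : Valued.v (n - 1) ≤ Valued.v ϖ ^ (2 * (d - 1)) := by
    rw [v_varpi_pow hϖ]; convert hnd using 2; push_cast; ring
  refine sum_eq_zero_of_twist S hS1 hS2 hS3 (fun g => normSign σ (1 + g)) (fun f hf f' hf' h => ?_) (fun g => n * (1 + g) - 1)
    (fun f hf => hAst f hf n hσn hn1 hnd') (fun f _ f' _ h => ?_) (fun f hf => ?_)
  · exact (normSign_one_add_eq_of_near hD (n := ρ + 2 * t) (by omega) (hA f hf).1 (hA f' hf').1 (hlt1 f hf) h).symm
  · rwa [show n * (1 + f) - 1 - (n * (1 + f') - 1) = n * (f - f') by ring, map_mul, hn1, one_mul] at h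
  · have h1f : (1 : K) + f ≠ 0 := fun h0 => by have h := Valued.v.map_one_add_of_lt (hlt1 f hf); rw [h0, map_zero] at h; exact zero_ne_one h
    rw [show (1 : K) + (n * (1 + f) - 1) = n * (1 + f) by ring]
    exact normSign_mul_eq_neg_of_not_norm hD hσn hnn (by rw [map_add, map_one, (hA f hf).1]) h1f


/-- **THE BOUNDARY (`t + 1 = d`, `ρ ≥ 1`): `Σ_S ω(1+g) = −q^{⌈ρ∕2⌉−1}`** over a complete irredundant system `S` of ALL fixed elements of level `2t` modulo `𝔭^{ρ+2t}`.  The twist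
`x ↦ n(1+x) − 1` permutes the classes of the BALL `{|x| ≤ |ϖ|^{2t}}` (κG-B1: `q^{⌈ρ∕2⌉}` of them) and flips `ω(1+x)`, so the ball sum is `0`; the deep classes (`|x| ≤ |ϖ|^{2d}`) all carry
`ω(1+x) = +1` and number `q^{⌈ρ∕2⌉} − #R = q^{⌈ρ∕2⌉−1}` (★ (iv-c) `#R = (q−1)q^{⌈ρ∕2⌉−1}`). [cite: Serre1979, Ch. V §3 Prop. 5, Cor. 3; Ch. XV §2] [cite: LanglandsShelstad1987, §3] -/
theorem sum_normSign_one_add_boundary (hD : IsRamifiedQuadraticDatum σ ϖ d t₂) (h2 : Valued.v (2 : K) < 1) {ρ t : ℕ} (hρ : 1 ≤ ρ) (ht : 1 ≤ t) (hdt : t + 1 = d)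
    (S : Finset K) (hS1 : ∀ g ∈ S, σ g = g ∧ Valued.v g = Valued.v ϖ ^ (2 * t))
    (hS2 : ∀ f : K, σ f = f → Valued.v f = Valued.v ϖ ^ (2 * t) → ∃ g ∈ S, Valued.v (f - g) ≤ Valued.v ϖ ^ (ρ + 2 * t))
    (hS3 : ∀ g ∈ S, ∀ g' ∈ S, Valued.v (g - g') ≤ Valued.v ϖ ^ (ρ + 2 * t) → g = g') :
    ∑ g ∈ S, normSign σ (1 + g) = -((Nat.card 𝓀[K] : ℤ) ^ ((ρ + 1) / 2 - 1)) := by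
  classical
  obtain ⟨hσ, hvσ, hϖ, hfix, hdd, hd1, -⟩ := id hD
  have hϖ0 : ϖ ≠ 0 := fun h0 => by rw [h0, map_zero] at hϖ; exact WithZero.coe_ne_zero hϖ.symm
  have hvϖ : 0 < Valued.v ϖ := (Valuation.pos_iff _).2 hϖ0
  have hϖ1 : Valued.v ϖ < 1 := by rw [hϖ, ← exp_zero, exp_lt_exp]; norm_num
  have hmono : ∀ {a b : ℕ}, a ≤ b → Valued.v ϖ ^ b ≤ Valued.v ϖ ^ a := fun h => pow_le_pow_right_of_le_one' hϖ1.le h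
  -- the BALL system and its exact ∕ deep parts
  obtain ⟨B, hB1, hB2, hB3, hBcard⟩ := exists_repr_fixedBall_card hσ hvσ hfix hϖ hdd ρ t
  set Bex : Finset K := B.filter (fun x => Valued.v x = Valued.v ϖ ^ (2 * t)) with hBex
  set Bdp : Finset K := B.filter (fun x => ¬ Valued.v x = Valued.v ϖ ^ (2 * t)) with hBdp
  have hsplit : ∑ x ∈ B, normSign σ (1 + x) = ∑ x ∈ Bex, normSign σ (1 + x) + ∑ x ∈ Bdp, normSign σ (1 + x) :=
    (Finset.sum_filter_add_sum_filter_not B (fun x => Valued.v x = Valued.v ϖ ^ (2 * t)) _).symm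
  have hcard : B.card = Bex.card + Bdp.card := (Finset.card_filter_add_card_filter_not _).symm
  -- deep members have `|x| ≤ |ϖ|^{2t+2}`
  have hdpv : ∀ x ∈ Bdp, σ x = x ∧ Valued.v x ≤ Valued.v ϖ ^ (2 * t + 2) := fun x hx => by
    obtain ⟨hxB, hne⟩ := Finset.mem_filter.1 hx
    exact ⟨(hB1 x hxB).1, v_le_pow_succ_succ_of_fixed_of_v_lt hfix hϖ t (hB1 x hxB).1 (lt_of_le_of_ne (hB1 x hxB).2 hne)⟩
  -- (1) the whole ball: the twist `x ↦ n(1+x) − 1` kills the sum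
  obtain ⟨n, hσn, hn1, hnd, hnn⟩ := exists_fixed_unit_not_norm_v_sub_one_le hD h2
  have hnd' : Valued.v (n - 1) ≤ Valued.v ϖ ^ (2 * t) := by
    rw [v_varpi_pow hϖ]; convert hnd using 2; push_cast; omega
  have hlt1 : ∀ x : K, Valued.v x ≤ Valued.v ϖ ^ (2 * t) → Valued.v x < 1 := fun x hx =>
    hx.trans_lt (pow_lt_one₀ zero_le hϖ1 (by omega))
  have hball : ∑ x ∈ B, normSign σ (1 + x) = 0 := by
    refine sum_eq_zero_of_twist (A := {x : K | σ x = x ∧ Valued.v x ≤ Valued.v ϖ ^ (2 * t)}) (r := Valued.v ϖ ^ (ρ + 2 * t)) B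
      (fun g hg => hB1 g hg) (fun f hf => hB2 f hf.1 hf.2) hB3 (fun x => normSign σ (1 + x)) (fun f hf f' hf' h => ?_)
      (fun x => n * (1 + x) - 1) (fun f hf => ⟨?_, ?_⟩) (fun f _ f' _ h => ?_) (fun f hf => ?_)
    · exact (normSign_one_add_eq_of_near hD (n := ρ + 2 * t) (by omega) hf.1 hf'.1 (hlt1 f hf.2) h).symm
    · rw [map_sub, map_mul, map_add, map_one, hσn, hf.1]
    · rw [show n * (1 + f) - 1 = n * f + (n - 1) by ring]
      refine Valuation.map_add_le _ ?_ hnd'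
      rw [map_mul, hn1, one_mul]; exact hf.2
    · rwa [show n * (1 + f) - 1 - (n * (1 + f') - 1) = n * (f - f') by ring, map_mul, hn1, one_mul] at h
    · have h1f : (1 : K) + f ≠ 0 := fun h0 => by have h := Valued.v.map_one_add_of_lt (hlt1 f hf.2); rw [h0, map_zero] at h; exact zero_ne_one h
      rw [show (1 : K) + (n * (1 + f) - 1) = n * (1 + f) by ring]
      exact normSign_mul_eq_neg_of_not_norm hD hσn hnn (by rw [map_add, map_one, hf.1]) h1f
  -- (2) the deep part: all `+1`
  have hdeep : ∑ x ∈ Bdp, normSign σ (1 + x) = Bdp.card := by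
    rw [Finset.card_eq_sum_ones, Nat.cast_sum, Nat.cast_one]
    refine Finset.sum_congr rfl fun x hx => ?_
    exact normSign_eq_one_of_fixed_of_v_sub_one_le hD (by rw [map_add, map_one, (hdpv x hx).1]) (n := 2 * t + 2) (by omega)
      (by rw [add_sub_cancel_left]; exact (hdpv x hx).2)
  -- (3) the exact part is a system for the level: its sum is `Σ_S`, its size is `#R`
  have hex1 : ∀ g ∈ Bex, g ∈ {x : K | σ x = x ∧ Valued.v x = Valued.v ϖ ^ (2 * t)} := fun g hg => by
    obtain ⟨hgB, hv⟩ := Finset.mem_filter.1 hg; exact ⟨(hB1 g hgB).1, hv⟩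
  have hex2 : ∀ f ∈ {x : K | σ x = x ∧ Valued.v x = Valued.v ϖ ^ (2 * t)}, ∃ g ∈ Bex, Valued.v (f - g) ≤ Valued.v ϖ ^ (ρ + 2 * t) := by
    rintro f ⟨hσf, hvf⟩
    obtain ⟨g, hgB, hfg⟩ := hB2 f hσf hvf.le
    refine ⟨g, Finset.mem_filter.2 ⟨hgB, ?_⟩, hfg⟩
    -- `|g| = |f|` since `|f − g| < |f|`
    have hlt : Valued.v (f - g) < Valued.v f := hfg.trans_lt (by rw [hvf]; exact pow_lt_pow_right_of_lt_one₀ hvϖ hϖ1 (by omega))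
    rw [← hvf, ← Valuation.map_sub_eq_of_lt_left Valued.v hlt, sub_sub_cancel]
  have hex3 : ∀ g ∈ Bex, ∀ g' ∈ Bex, Valued.v (g - g') ≤ Valued.v ϖ ^ (ρ + 2 * t) → g = g' :=
    fun g hg g' hg' h => hB3 g (Finset.mem_filter.1 hg).1 g' (Finset.mem_filter.1 hg').1 h
  have hS1' : ∀ g ∈ S, g ∈ {x : K | σ x = x ∧ Valued.v x = Valued.v ϖ ^ (2 * t)} := fun g hg => hS1 g hg
  have hS2' : ∀ f ∈ {x : K | σ x = x ∧ Valued.v x = Valued.v ϖ ^ (2 * t)}, ∃ g ∈ S, Valued.v (f - g) ≤ Valued.v ϖ ^ (ρ + 2 * t) :=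
    fun f hf => hS2 f hf.1 hf.2
  have hsumS : ∑ x ∈ Bex, normSign σ (1 + x) = ∑ g ∈ S, normSign σ (1 + g) :=
    sum_eq_sum_of_repr Bex S hex1 hex2 hex3 hS1' hS2' hS3 (fun x => normSign σ (1 + x))
      (fun f hf f' hf' h => (normSign_one_add_eq_of_near hD (n := ρ + 2 * t) (by omega) hf.1 hf'.1 (hlt1 f hf.2.le) h).symm)
  -- `#Bex = #R = (q−1)q^{⌈ρ∕2⌉−1}` (★ (iv-c)), so `#Bdp = q^{⌈ρ∕2⌉−1}`
  obtain ⟨R, hRfin, hRcard, hR1, hR2, hR3⟩ := exists_fixed_class_representatives hσ hvσ hfix hϖ hdd ρ t hρ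
  have hmemR : ∀ g, g ∈ hRfin.toFinset ↔ g ∈ R := fun g => Set.Finite.mem_toFinset hRfin
  have hexcard : Bex.card = (Nat.card 𝓀[K] - 1) * Nat.card 𝓀[K] ^ ((ρ + 1) / 2 - 1) := by
    rw [← hRcard, Set.ncard_eq_toFinset_card R hRfin]
    exact card_eq_card_of_repr Bex hRfin.toFinset hex1 hex2 hex3 (fun g hg => hR1 g ((hmemR g).1 hg))
      (fun f hf => by obtain ⟨g, hg, h⟩ := hR2 f hf.1 hf.2; exact ⟨g, (hmemR g).2 hg, h⟩)
      (fun g hg g' hg' h => hR3 g ((hmemR g).1 hg) g' ((hmemR g').1 hg') h)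
  have hq1 : 1 ≤ Nat.card 𝓀[K] := Nat.one_le_iff_ne_zero.2 Nat.card_pos.ne'
  set e : ℕ := (ρ + 1) / 2 - 1 with he
  have he' : (ρ + 1) / 2 = e + 1 := by omega
  have hdpcard : (Bdp.card : ℤ) = (Nat.card 𝓀[K] : ℤ) ^ e := by
    have h := hcard
    rw [hBcard, hexcard, he', pow_succ] at h
    zify [hq1] at h
    linear_combination -h
  rw [← hsumS]
  have h := hsplit
  rw [hball, hdeep] at h
  linear_combination -h - hdpcard


/-! ## §4  The sub-balls `{g = σg : |g − c₀| ≤ |ϖ|^k}` of the level (`|c₀| = |ϖ|^{2t}`, `2t < k ≤ ρ + 2t`): level, stability, count, constant sums -/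

omit [CompleteSpace K] [Finite 𝓀[K]] in
/-- A member of the sub-ball `{g = σg : |g − c₀| ≤ |ϖ|^k}` (`σc₀ = c₀`, `|c₀| = |ϖ|^{2t}`, `2t < k`) is fixed of valuation EXACTLY `|ϖ|^{2t}`. [cite: Serre1979, Ch. V §3 Prop. 5, Cor. 3] -/
theorem level_of_mem_subBall (hD : IsRamifiedQuadraticDatum σ ϖ d t₂) {t k : ℕ} (hk : 2 * t < k) {c₀ : K} (hc₀ : Valued.v c₀ = Valued.v ϖ ^ (2 * t))
    {g : K} (hg : g ∈ {g : K | σ g = g ∧ Valued.v (g - c₀) ≤ Valued.v ϖ ^ k}) : σ g = g ∧ Valued.v g = Valued.v ϖ ^ (2 * t) := by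
  have hϖ := hD.2.2.1
  have hϖ0 : ϖ ≠ 0 := fun h0 => by rw [h0, map_zero] at hϖ; exact WithZero.coe_ne_zero hϖ.symm
  have hvϖ : 0 < Valued.v ϖ := (Valuation.pos_iff _).2 hϖ0
  have hϖ1 : Valued.v ϖ < 1 := by rw [hϖ, ← exp_zero, exp_lt_exp]; norm_num
  refine ⟨hg.1, ?_⟩
  have hlt : Valued.v (g - c₀) < Valued.v c₀ := hg.2.trans_lt (by rw [hc₀]; exact pow_lt_pow_right_of_lt_one₀ hvϖ hϖ1 hk)
  rw [← hc₀, ← Valuation.map_add_eq_of_lt_left _ hlt, add_sub_cancel]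

omit [CompleteSpace K] [Finite 𝓀[K]] in
/-- **THE SUB-BALL IS STABLE UNDER `g ↦ n·g`** for fixed units `n ≡ 1 (ϖ^{2d−2})` when `k ≤ 2d − 2 + 2t` (`|ng − c₀| ≤ max(|g − c₀|, |n−1||c₀|)`). [cite: Serre1979, Ch. V §3 Prop. 5, Cor. 3] -/
theorem mul_mem_subBall (hD : IsRamifiedQuadraticDatum σ ϖ d t₂) {t k : ℕ} (hk' : k ≤ 2 * (d - 1) + 2 * t) {c₀ : K} (hc₀ : Valued.v c₀ = Valued.v ϖ ^ (2 * t))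
    {g : K} (hg : g ∈ {g : K | σ g = g ∧ Valued.v (g - c₀) ≤ Valued.v ϖ ^ k}) {n : K} (hσn : σ n = n) (hn1 : Valued.v n = 1)
    (hn : Valued.v (n - 1) ≤ Valued.v ϖ ^ (2 * (d - 1))) : n * g ∈ {g : K | σ g = g ∧ Valued.v (g - c₀) ≤ Valued.v ϖ ^ k} := by
  have hϖ := hD.2.2.1
  have hϖ1 : Valued.v ϖ < 1 := by rw [hϖ, ← exp_zero, exp_lt_exp]; norm_num
  refine ⟨by rw [map_mul, hσn, hg.1], ?_⟩
  rw [show n * g - c₀ = n * (g - c₀) + (n - 1) * c₀ by ring]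
  refine Valuation.map_add_le _ (by rw [map_mul, hn1, one_mul]; exact hg.2) ?_
  rw [map_mul, hc₀]
  exact (mul_le_mul_left hn _).trans (by rw [← pow_add]; exact pow_le_pow_right_of_le_one' hϖ1.le hk')

omit [CompleteSpace K] [Finite 𝓀[K]] in
/-- **THE SUB-BALL IS STABLE UNDER `g ↦ n(1+g) − 1`** for fixed units `n ≡ 1 (ϖ^{2d−2})` when `k ≤ 2d − 2` (`|n(1+g) − 1 − c₀| ≤ max(|g − c₀|, |n − 1|)`).
[cite: Serre1979, Ch. V §3 Prop. 5, Cor. 3] -/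
theorem twist_mem_subBall (hD : IsRamifiedQuadraticDatum σ ϖ d t₂) {t k : ℕ} (hk' : k ≤ 2 * (d - 1)) {c₀ : K} (hc₀ : Valued.v c₀ = Valued.v ϖ ^ (2 * t))
    {g : K} (hg : g ∈ {g : K | σ g = g ∧ Valued.v (g - c₀) ≤ Valued.v ϖ ^ k}) {n : K} (hσn : σ n = n) (hn1 : Valued.v n = 1)
    (hn : Valued.v (n - 1) ≤ Valued.v ϖ ^ (2 * (d - 1))) : n * (1 + g) - 1 ∈ {g : K | σ g = g ∧ Valued.v (g - c₀) ≤ Valued.v ϖ ^ k} := by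
  have hϖ := hD.2.2.1
  have hϖ1 : Valued.v ϖ < 1 := by rw [hϖ, ← exp_zero, exp_lt_exp]; norm_num
  have hc₀1 : Valued.v c₀ ≤ 1 := by rw [hc₀]; exact pow_le_one₀ zero_le hϖ1.le
  refine ⟨by rw [map_sub, map_mul, map_add, map_one, hσn, hg.1], ?_⟩
  rw [show n * (1 + g) - 1 - c₀ = n * (g - c₀) + (n - 1) * (1 + c₀) by ring]
  refine Valuation.map_add_le _ (by rw [map_mul, hn1, one_mul]; exact hg.2) ?_
  rw [map_mul]
  refine (mul_le_mul' hn ((Valuation.map_add _ _ _).trans (max_le (le_of_eq Valued.v.map_one) hc₀1))).trans ?_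
  rw [mul_one]; exact pow_le_pow_right_of_le_one' hϖ1.le hk'

omit [CompleteSpace K] in
/-- **THE SUB-BALL HAS `q^{⌈(ρ+2t)∕2⌉ − ⌈k∕2⌉}` CLASSES MODULO `𝔭^{ρ+2t}`** (`k ≤ ρ + 2t`, `σc₀ = c₀`): translate by `−c₀` to the fixed ball of level `2⌈k∕2⌉` (parity) and count with κG-B1
`exists_repr_fixedBall_card` ∕ `card_eq_card_of_repr`. [cite: Serre1979, Ch. IV §2 Prop. 6] -/
theorem card_repr_subBall (hD : IsRamifiedQuadraticDatum σ ϖ d t₂) {ρ t k : ℕ} (hkρ : k ≤ ρ + 2 * t) {c₀ : K} (hσc₀ : σ c₀ = c₀)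
    (S : Finset K) (hS1 : ∀ g ∈ S, g ∈ {g : K | σ g = g ∧ Valued.v (g - c₀) ≤ Valued.v ϖ ^ k})
    (hS2 : ∀ f ∈ {g : K | σ g = g ∧ Valued.v (g - c₀) ≤ Valued.v ϖ ^ k}, ∃ g ∈ S, Valued.v (f - g) ≤ Valued.v ϖ ^ (ρ + 2 * t))
    (hS3 : ∀ g ∈ S, ∀ g' ∈ S, Valued.v (g - g') ≤ Valued.v ϖ ^ (ρ + 2 * t) → g = g') :
    S.card = Nat.card 𝓀[K] ^ ((ρ + 2 * t + 1) / 2 - (k + 1) / 2) := by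
  classical
  obtain ⟨hσ, hvσ, hϖ, hfix, hdd, hd1, -⟩ := id hD
  have hϖ0 : ϖ ≠ 0 := fun h0 => by rw [h0, map_zero] at hϖ; exact WithZero.coe_ne_zero hϖ.symm
  have hvϖ : 0 < Valued.v ϖ := (Valuation.pos_iff _).2 hϖ0
  have hϖ1 : Valued.v ϖ < 1 := by rw [hϖ, ← exp_zero, exp_lt_exp]; norm_num
  have hmono : ∀ {a b : ℕ}, a ≤ b → Valued.v ϖ ^ b ≤ Valued.v ϖ ^ a := fun h => pow_le_pow_right_of_le_one' hϖ1.le h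
  -- the even level `2B ≥ k` of the translated ball (parity)
  set B : ℕ := (k + 1) / 2 with hB
  have hkB : k ≤ 2 * B := by omega
  have hparity : ∀ x : K, σ x = x → Valued.v x ≤ Valued.v ϖ ^ k → Valued.v x ≤ Valued.v ϖ ^ (2 * B) := by
    intro x hσx hx
    rcases Nat.even_or_odd k with ⟨j, hj⟩ | ⟨j, hj⟩
    · rw [show 2 * B = k by omega]; exact hx
    · have hlt : Valued.v x < Valued.v ϖ ^ (2 * j) := hx.trans_lt (by rw [hj]; exact pow_lt_pow_right_of_lt_one₀ hvϖ hϖ1 (by omega))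
      rw [show 2 * B = 2 * j + 2 by omega]; exact v_le_pow_succ_succ_of_fixed_of_v_lt hfix hϖ j hσx hlt
  -- the translated system `S − c₀` represents the ball of level `2B` modulo `ϖ^{ρ+2t}`
  set S' : Finset K := S.image (fun g => g - c₀) with hS'
  have hinj : Set.InjOn (fun g : K => g - c₀) S := fun a _ b _ h => by simpa using h
  have hS'card : S'.card = S.card := Finset.card_image_of_injOn hinj
  have hS'1 : ∀ x ∈ S', x ∈ {x : K | σ x = x ∧ Valued.v x ≤ Valued.v ϖ ^ (2 * B)} := by
    intro x hx
    obtain ⟨g, hg, rfl⟩ := Finset.mem_image.1 hx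
    have h := hS1 g hg
    exact ⟨by rw [map_sub, h.1, hσc₀], hparity _ (by rw [map_sub, h.1, hσc₀]) h.2⟩
  have hS'2 : ∀ f ∈ {x : K | σ x = x ∧ Valued.v x ≤ Valued.v ϖ ^ (2 * B)}, ∃ x ∈ S', Valued.v (f - x) ≤ Valued.v ϖ ^ (ρ + 2 * t) := by
    rintro f ⟨hσf, hvf⟩
    obtain ⟨g, hg, hfg⟩ := hS2 (f + c₀) ⟨by rw [map_add, hσf, hσc₀], by rw [add_sub_cancel_right]; exact hvf.trans (hmono hkB)⟩
    exact ⟨g - c₀, Finset.mem_image.2 ⟨g, hg, rfl⟩, by rw [show f - (g - c₀) = f + c₀ - g by ring]; exact hfg⟩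
  have hS'3 : ∀ x ∈ S', ∀ x' ∈ S', Valued.v (x - x') ≤ Valued.v ϖ ^ (ρ + 2 * t) → x = x' := by
    intro x hx x' hx' h
    obtain ⟨g, hg, rfl⟩ := Finset.mem_image.1 hx
    obtain ⟨g', hg', rfl⟩ := Finset.mem_image.1 hx'
    rw [hS3 g hg g' hg' (by rw [show g - g' = g - c₀ - (g' - c₀) by ring]; exact h)]
  rw [← hS'card]
  rcases le_or_gt (2 * B) (ρ + 2 * t) with hle | hlt
  · -- modulus at or above the level: κG-B1 with `(ρ′, t′) = (ρ + 2t − 2B, B)`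
    obtain ⟨T, hT1, hT2, hT3, hTcard⟩ := exists_repr_fixedBall_card hσ hvσ hfix hϖ hdd (ρ + 2 * t - 2 * B) B
    have e : ρ + 2 * t - 2 * B + 2 * B = ρ + 2 * t := by omega
    rw [e] at hT2 hT3
    rw [card_eq_card_of_repr S' T hS'1 hS'2 hS'3 (fun g hg => hT1 g hg) (fun f hf => hT2 f hf.1 hf.2) hT3, hTcard]
    congr 1; omega
  · -- modulus below the level (`ρ + 2t = 2B − 1`): one class
    have hone : ∀ x ∈ S', ∀ x' ∈ S', x = x' := fun x hx x' hx' =>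
      hS'3 x hx x' hx' ((Valuation.map_sub _ _ _).trans (max_le ((hS'1 x hx).2.trans (hmono hlt.le)) ((hS'1 x' hx').2.trans (hmono hlt.le))))
    obtain ⟨x, hx, -⟩ := hS'2 0 ⟨map_zero σ, by rw [map_zero]; exact zero_le⟩
    rw [Finset.card_eq_one.2 ⟨x, Finset.eq_singleton_iff_unique_mem.2 ⟨hx, fun y hy => hone y hy x hx⟩⟩, show (ρ + 2 * t + 1) / 2 - (k + 1) / 2 = 0 by omega,
      pow_zero]

omit [Finite 𝓀[K]] in
/-- **CONSTANT ON A DEEP SUB-BALL, I (`2d − 1 ≤ k`): `Σ_S ω(1+g) = #S · ω(1+c₀)`.** [cite: Serre1979, Ch. XV §2] -/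
theorem sum_normSign_one_add_subBall_eq (hD : IsRamifiedQuadraticDatum σ ϖ d t₂) {t k : ℕ} (ht : 1 ≤ t) (hkd : 2 * d - 1 ≤ k) {c₀ : K} (hσc₀ : σ c₀ = c₀)
    (hc₀ : Valued.v c₀ = Valued.v ϖ ^ (2 * t)) (S : Finset K) (hS1 : ∀ g ∈ S, g ∈ {g : K | σ g = g ∧ Valued.v (g - c₀) ≤ Valued.v ϖ ^ k}) :
    ∑ g ∈ S, normSign σ (1 + g) = (S.card : ℤ) * normSign σ (1 + c₀) := by
  have hϖ := hD.2.2.1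
  have hϖ1 : Valued.v ϖ < 1 := by rw [hϖ, ← exp_zero, exp_lt_exp]; norm_num
  have hc₀lt : Valued.v c₀ < 1 := by rw [hc₀]; exact pow_lt_one₀ zero_le hϖ1 (by omega)
  rw [Finset.sum_congr rfl fun g hg => (normSign_one_add_eq_of_near hD hkd hσc₀ (hS1 g hg).1 hc₀lt
    (by rw [Valuation.map_sub_swap]; exact (hS1 g hg).2)), Finset.sum_const, nsmul_eq_mul]

omit [Finite 𝓀[K]] in
/-- **CONSTANT ON A DEEP SUB-BALL, II (`2d − 1 + 2t ≤ k`): `Σ_S ω(g) = #S · ω(c₀)` and `Σ_S ω(g)ω(1+g) = #S · ω(c₀)ω(1+c₀)`.** [cite: Serre1979, Ch. XV §2] -/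
theorem sum_normSign_subBall_eq (hD : IsRamifiedQuadraticDatum σ ϖ d t₂) {t k : ℕ} (ht : 1 ≤ t) (hkd : 2 * d - 1 + 2 * t ≤ k) {c₀ : K} (hσc₀ : σ c₀ = c₀)
    (hc₀ : Valued.v c₀ = Valued.v ϖ ^ (2 * t)) (S : Finset K) (hS1 : ∀ g ∈ S, g ∈ {g : K | σ g = g ∧ Valued.v (g - c₀) ≤ Valued.v ϖ ^ k}) :
    ∑ g ∈ S, normSign σ g = (S.card : ℤ) * normSign σ c₀ ∧
      ∑ g ∈ S, normSign σ g * normSign σ (1 + g) = (S.card : ℤ) * (normSign σ c₀ * normSign σ (1 + c₀)) := by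
  have hϖ := hD.2.2.1
  have hϖ1 : Valued.v ϖ < 1 := by rw [hϖ, ← exp_zero, exp_lt_exp]; norm_num
  have hc₀lt : Valued.v c₀ < 1 := by rw [hc₀]; exact pow_lt_one₀ zero_le hϖ1 (by omega)
  have hω : ∀ g ∈ S, normSign σ g = normSign σ c₀ := fun g hg =>
    normSign_eq_of_near_level hD (ρ := k - 2 * t) (t := t) (by omega) hσc₀ (hS1 g hg).1 hc₀
      (by rw [show k - 2 * t + 2 * t = k by omega, Valuation.map_sub_swap]; exact (hS1 g hg).2)
  have hω1 : ∀ g ∈ S, normSign σ (1 + g) = normSign σ (1 + c₀) := fun g hg =>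
    normSign_one_add_eq_of_near hD (n := k) (by omega) hσc₀ (hS1 g hg).1 hc₀lt (by rw [Valuation.map_sub_swap]; exact (hS1 g hg).2)
  refine ⟨?_, ?_⟩
  · rw [Finset.sum_congr rfl hω, Finset.sum_const, nsmul_eq_mul]
  · rw [Finset.sum_congr rfl fun g hg => by rw [hω g hg, hω1 g hg], Finset.sum_const, nsmul_eq_mul]

end Summit.HodgeConjecture.HodgeConjecture.Cruxes.H413.F0P3cDyRamDiagonalKappaGluedClassSums

end
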